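import Literature.Geometry.Lorentzian.AdiabaticTracking
import Literature.Geometry.Lorentzian.ApproximateKerrConfigurationReanchor
import HarnessLib

/-!
# Adiabatic tracking from chains of windows with free start times

`VacuumCauchyDevelopment.IsAdiabaticallyTracked` (`AdiabaticTracking.lean`) asks for a chain of
`ε`-approximate `N`-Kerr configurations each read on the chart-time window `[0, L]` OF ITS OWN
CHARTS — the start time `0` is a normalisation. This file records that normalisation as a theorem:
a chain of configurations on windows `[τₙ, τₙ + L]` with ARBITRARY start times `τₙ` (as produced,
e.g., on the late windows of a final state decomposition by
`FinalStateDecomposition.eventually_nonempty_approximateKerrConfiguration`), satisfying the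
radii / complexity / chaining / exhaustion / pinning / covering clauses of the seam verbatim with
"start slab at time `0`" read as "start slab at time `τₙ`", IS an adiabatically tracked development
(`VacuumCauchyDevelopment.isAdiabaticallyTracked_of_windows`): each configuration is re-anchored
to chart time `0` by `ApproximateKerrConfiguration.reanchor`
(`ApproximateKerrConfigurationReanchor.lean`), which keeps the number of holes, the parameters,
the certified window images and carries the certified slab at `τₙ` to the start slab. Conversely
a tracked development is such a chain with `τₙ = 0` (`IsAdiabaticallyTracked.exists_windows`),
whence the `iff` form `isAdiabaticallyTracked_iff_exists_windows`.

Consumer: route `RenormalisedDrift` of the final state conjecture (crux `AdiabaticTracking`,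
stmt-FinalStateConjecture-17504; crux `DriftCapture`): any argument that feeds late windows of an
honest decomposition into the seam. Klainerman, C. R. Mécanique 353 (2025), §1.1.1 and §2.3
(orbital closeness window by window); DHRT arXiv:2104.08222, §1 (slabs of a time function).

## References

* S. Klainerman, *The black hole stability problem*, C. R. Mécanique 353 (2025) 555–581, §1.1.1, §2.3.
* M. Dafermos, G. Holzegel, I. Rodnianski, M. Taylor, arXiv:2104.08222, §1.
-/

noncomputable section

open Set TopologicalSpace Filter Function
open scoped Manifold ContDiff Topology ENNReal

universe u

namespace Literature.Geometry.Lorentzian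

namespace VacuumCauchyDevelopment

variable {X : Type u} [TopologicalSpace X] [ChartedSpace E3 X] [IsManifold (𝓡 3) ∞ X]
  [ConnectedSpace X] {D : InitialDataSet (𝓡 3) X} {𝒟 : VacuumCauchyDevelopment D}
  {N : ℕ} {m₀ χ : ℝ} {ε : ℝ≥0∞} {L R₀ : ℝ}

/-- **Adiabatic tracking from a chain of windows with free start times.** If `𝒟` carries
near-zone radii `Rₙ ≥ R₀`, `Rₙ → ∞`, a region `O`, start times `τₙ` and a chain of
`ε`-approximate Kerr configurations `cₙ` of `O` in `C²` on the windows `[τₙ, τₙ + L]` with radius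
`Rₙ`, each with exactly `N` holes of masses in `[m₀, m₀⁻¹]` and spins `|aᵢ| ≤ χ Mᵢ`, such that the
certified slab of `cₙ₊₁` at ITS start time `τₙ₊₁` lies in the certified window image of `cₙ`, the
window images leave every compact past, `O = J⁺(ι X) ∩ I⁻(⋃ₙ window images)`, and
`O ⊆ J⁻(certified slab of c₀ at τ₀) ∪ ⋃ₙ window images`, then `𝒟` is adiabatically tracked at
accuracy `(ε, L, R₀)` with complexity `(N, m₀, χ)`: re-anchor every window to chart time `0`
(`ApproximateKerrConfiguration.reanchor`; window images are kept, `windowImage_reanchor`, and the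
start slab becomes the old slab at `τₙ`, `certifiedSlab_reanchor_zero`).
[cite: Klainerman2025, §1.1.1 and §2.3] -/
theorem isAdiabaticallyTracked_of_windows (τ R : ℕ → ℝ) (O : Set 𝒟.carrier)
    (c : ∀ n : ℕ, ApproximateKerrConfiguration 𝒟.toSpacetime O 2 ε (τ n) L (R n))
    (hR : ∀ n, R₀ ≤ R n) (hRt : Tendsto R atTop atTop) (hN : ∀ n, (c n).N = N)
    (hM : ∀ n (i : Fin (c n).N), m₀ ≤ (c n).mass i ∧ (c n).mass i ≤ m₀⁻¹ ∧
      |(c n).spin i| ≤ χ * (c n).mass i)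
    (hch : ∀ n, (c (n + 1)).certifiedSlab (τ (n + 1)) ⊆ (c n).windowImage)
    (hex : ∀ K : Set 𝒟.carrier, IsCompact K → ∃ n₀ : ℕ, ∀ n, n₀ ≤ n →
      Disjoint (c n).windowImage (𝒟.metric.causalPast 𝒟.timeOrientation K))
    (hO : O = 𝒟.toCauchyDevelopment.exteriorOf (⋃ n, (c n).windowImage))
    (hcov : O ⊆ 𝒟.metric.causalPast 𝒟.timeOrientation ((c 0).certifiedSlab (τ 0)) ∪
      ⋃ n, (c n).windowImage) :
    𝒟.IsAdiabaticallyTracked N m₀ χ ε L R₀ := by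
  refine ⟨R, O, fun n ↦ (c n).reanchor, hR, hRt, hN, hM, fun n ↦ ?_, fun K hK ↦ ?_, ?_, ?_⟩
  · rw [(c (n + 1)).certifiedSlab_reanchor_zero, (c n).windowImage_reanchor]
    exact hch n
  · obtain ⟨n₀, hn₀⟩ := hex K hK
    exact ⟨n₀, fun n hn ↦ by rw [(c n).windowImage_reanchor]; exact hn₀ n hn⟩
  · rw [iUnion_congr fun n ↦ (c n).windowImage_reanchor]
    exact hO
  · rw [(c 0).certifiedSlab_reanchor_zero, iUnion_congr fun n ↦ (c n).windowImage_reanchor]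
    exact hcov

/-- Conversely, a tracked development is a chain of windows in the free-start-time form, with
all start times `0` (bookkeeping). [folklore] -/
theorem IsAdiabaticallyTracked.exists_windows (h : 𝒟.IsAdiabaticallyTracked N m₀ χ ε L R₀) :
    ∃ (τ R : ℕ → ℝ) (O : Set 𝒟.carrier)
      (c : ∀ n : ℕ, ApproximateKerrConfiguration 𝒟.toSpacetime O 2 ε (τ n) L (R n)),
      (∀ n, R₀ ≤ R n) ∧ Tendsto R atTop atTop ∧ (∀ n, (c n).N = N) ∧
      (∀ n (i : Fin (c n).N), m₀ ≤ (c n).mass i ∧ (c n).mass i ≤ m₀⁻¹ ∧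
        |(c n).spin i| ≤ χ * (c n).mass i) ∧
      (∀ n, (c (n + 1)).certifiedSlab (τ (n + 1)) ⊆ (c n).windowImage) ∧
      (∀ K : Set 𝒟.carrier, IsCompact K → ∃ n₀ : ℕ, ∀ n, n₀ ≤ n →
        Disjoint (c n).windowImage (𝒟.metric.causalPast 𝒟.timeOrientation K)) ∧
      O = 𝒟.toCauchyDevelopment.exteriorOf (⋃ n, (c n).windowImage) ∧
      O ⊆ 𝒟.metric.causalPast 𝒟.timeOrientation ((c 0).certifiedSlab (τ 0)) ∪
        ⋃ n, (c n).windowImage := by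
  obtain ⟨R, O, c, hR, hRt, hN, hM, hch, hex, hO, hcov⟩ := h
  exact ⟨fun _ ↦ 0, R, O, c, hR, hRt, hN, hM, hch, hex, hO, hcov⟩

/-- **The start time is a normalisation**: `𝒟` is adiabatically tracked at accuracy
`(ε, L, R₀)` with complexity `(N, m₀, χ)` iff it carries a chain of windows with free start times
satisfying the clauses of the seam read at those start times. [cite: Klainerman2025, §1.1.1 and §2.3] -/
theorem isAdiabaticallyTracked_iff_exists_windows :
    𝒟.IsAdiabaticallyTracked N m₀ χ ε L R₀ ↔
      ∃ (τ R : ℕ → ℝ) (O : Set 𝒟.carrier)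
        (c : ∀ n : ℕ, ApproximateKerrConfiguration 𝒟.toSpacetime O 2 ε (τ n) L (R n)),
        (∀ n, R₀ ≤ R n) ∧ Tendsto R atTop atTop ∧ (∀ n, (c n).N = N) ∧
        (∀ n (i : Fin (c n).N), m₀ ≤ (c n).mass i ∧ (c n).mass i ≤ m₀⁻¹ ∧
          |(c n).spin i| ≤ χ * (c n).mass i) ∧
        (∀ n, (c (n + 1)).certifiedSlab (τ (n + 1)) ⊆ (c n).windowImage) ∧
        (∀ K : Set 𝒟.carrier, IsCompact K → ∃ n₀ : ℕ, ∀ n, n₀ ≤ n →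
          Disjoint (c n).windowImage (𝒟.metric.causalPast 𝒟.timeOrientation K)) ∧
        O = 𝒟.toCauchyDevelopment.exteriorOf (⋃ n, (c n).windowImage) ∧
        O ⊆ 𝒟.metric.causalPast 𝒟.timeOrientation ((c 0).certifiedSlab (τ 0)) ∪
          ⋃ n, (c n).windowImage :=
  ⟨IsAdiabaticallyTracked.exists_windows, fun ⟨τ, R, O, c, hR, hRt, hN, hM, hch, hex, hO, hcov⟩ ↦
    isAdiabaticallyTracked_of_windows τ R O c hR hRt hN hM hch hex hO hcov⟩

end VacuumCauchyDevelopment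

end Literature.Geometry.Lorentzian

end
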